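import Summits.AtomisticToContinuum.Crystallization.Theorems.FrustratedLawDichotomyStrainedPatchHomWitnessSite
import Summits.AtomisticToContinuum.Crystallization.Theorems.FrustratedLawDichotomyStrainedPatchHomLatticeBoxWindow

/-!
# An ADMISSIBLE homogeneous hcp-type ball from parametric certificates, and `(R)` from a floor number plus those certificates
# (27623 strained-patch piece; decomp-a2c, prover hand 2, generation 20 — hcp twin of `…HomWitness`; the reference of record, family A, is hcp-type)

For the hcp family the ball `p + (U·L_hex ∪ (U·L_hex + U(hcpShift + ξ)))` has A-sites (displacement set `T_A = U·L_hex ∪ (U·L_hex + u)`) and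
B-sites (`T_B = U·L_hex ∪ (U·L_hex − u) = −T_A`).  This DEF-FREE module proves:

* §1 `exists_realisation_hcp`: the ball is finite (parametric boxes of `…HomLatticeBoxWindow`, box `[−22, 22]³`) and injectively enumerated;
* §2 ★ `admissible_of_certificates_hcp` (`‖U − 1‖ ≤ 1/4`, `‖ξ‖ ≤ 1/4`): `Admissible M z c` for every injective enumeration, from the cluster-free
  certificates of `…HomWitness` stated for BOTH displacement sets `T_A` and `T_B` (the same data serve, `T_B = −T_A`), plus the A–B SEPARATION
  certificate `∀ d, 7/10 ≤ ‖latPt U hexFrame d + U (hcpShift + ξ)‖` (A–A and B–B separation `≥ 3/4` is automatic);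
* §3 ★★ `textureReliefBound_of_floor_of_certificates_hcp`: `(R)` from the floor number `X_hcp(U, ξ) − (L·σ₁ + B) ≤ ballAvg` plus the certificates.

0 sorry; no definitions; axioms ⊆ {propext, Classical.choice, Quot.sound}.  `--supports stmt-AtomisticToContinuum-27623`.
-/

noncomputable section

namespace Summit.AtomisticToContinuum.Crystallization.Theorems.FrustratedLawDichotomyStrainedPatchHomWitnessHcp

open scoped BigOperators Classical
open Summit.AtomisticToContinuum.Crystallization.Theorems.ChargedEnergyGapNegative (E3)
open Summit.AtomisticToContinuum.Crystallization.Theorems.FrustratedLawDichotomyRangeCut (Sep)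
open Summit.AtomisticToContinuum.Crystallization.Theorems.FrustratedLawDichotomySchurCut (effPot w₄₅ ω₄)
open Summit.AtomisticToContinuum.Crystallization.Theorems.FrustratedLawDichotomyMotifLemmas (GoodAtScale)
open Summit.AtomisticToContinuum.Crystallization.Theorems.FrustratedLawDichotomyAveragingCut (ball ballAvg mem_ball)
open Summit.AtomisticToContinuum.Crystallization.Theorems.FrustratedLawDichotomyExemptAbsorptionRecord (MoveUnstableCore RemovalUnstableCore)
open Summit.AtomisticToContinuum.Crystallization.Theorems.FrustratedLawDichotomyCollarCensus (Collar)
open Summit.AtomisticToContinuum.Crystallization.Theorems.FrustratedLawDichotomyStrainedPatchHomSplit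
open Summit.AtomisticToContinuum.Crystallization.Theorems.FrustratedLawDichotomyStrainedPatchHomLattice
open Summit.AtomisticToContinuum.Crystallization.Theorems.FrustratedLawDichotomyStrainedPatchHomRelief
open Summit.AtomisticToContinuum.Crystallization.Theorems.FrustratedLawDichotomyStrainedPatchHomLatticeBox
open Summit.AtomisticToContinuum.Crystallization.Theorems.FrustratedLawDichotomyStrainedPatchHomLatticeBoxHcp
open Summit.AtomisticToContinuum.Crystallization.Theorems.FrustratedLawDichotomyStrainedPatchHomLatticeBoxWindow
open Summit.AtomisticToContinuum.Crystallization.Theorems.FrustratedLawDichotomyStrainedPatchHomWitnessSite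
open Literature.Barriers.AtomisticToContinuum.FlatleyTheil2015 (fccVec)

/-! ## §0. Closed-radius homogeneity at A- and B-sites (reach sites need radius exactly `7`: `63/10 + 7 = 133/10`) -/

/-- hcp ball, A-site within `ρ` of the centre, CLOSED radius `r` (`r + ρ ≤ 133/10`). [folklore] -/
theorem locHom_hcpA_site_closed {M : ℕ} {z : Fin M → E3} {c k : Fin M} {G : E3 →L[ℝ] E3} {ξ : E3} {ρ r : ℝ}
    (hrange : Set.range z = {x : E3 | dist x (z c) ≤ 133 / 10 ∧ ∃ a : Fin 3 → ℤ,
      x = z c + latPt G hexFrame a ∨ x = z c + latPt G hexFrame a + G (hcpShift + ξ)})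
    (hk : dist (z k) (z c) ≤ ρ) (hr : r + ρ ≤ 133 / 10) {ak : Fin 3 → ℤ} (hak : z k = z c + latPt G hexFrame ak) :
    ∀ x : E3, dist x (z k) ≤ r → (x ∈ Set.range z ↔
      x - z k ∈ {v : E3 | ∃ b : Fin 3 → ℤ, v = latPt G hexFrame b ∨ v = latPt G hexFrame b + G (hcpShift + ξ)}) := by
  intro x hx
  rw [hrange]
  constructor
  · rintro ⟨-, a, ha | ha⟩
    · exact ⟨a - ak, Or.inl (by rw [latPt_sub, ha, hak]; abel)⟩
    · exact ⟨a - ak, Or.inr (by rw [latPt_sub, ha, hak]; abel)⟩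
  · rintro ⟨b, hb | hb⟩
    · refine ⟨by linarith [dist_triangle x (z k) (z c)], ak + b, Or.inl ?_⟩
      rw [latPt_add, ← sub_add_cancel x (z k), hb, hak]
      abel
    · refine ⟨by linarith [dist_triangle x (z k) (z c)], ak + b, Or.inr ?_⟩
      rw [latPt_add, ← sub_add_cancel x (z k), hb, hak]
      abel

/-- hcp ball, B-site within `ρ` of the centre, CLOSED radius `r` (`r + ρ ≤ 133/10`). [folklore] -/
theorem locHom_hcpB_site_closed {M : ℕ} {z : Fin M → E3} {c k : Fin M} {G : E3 →L[ℝ] E3} {ξ : E3} {ρ r : ℝ}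
    (hrange : Set.range z = {x : E3 | dist x (z c) ≤ 133 / 10 ∧ ∃ a : Fin 3 → ℤ,
      x = z c + latPt G hexFrame a ∨ x = z c + latPt G hexFrame a + G (hcpShift + ξ)})
    (hk : dist (z k) (z c) ≤ ρ) (hr : r + ρ ≤ 133 / 10) {ak : Fin 3 → ℤ} (hak : z k = z c + latPt G hexFrame ak + G (hcpShift + ξ)) :
    ∀ x : E3, dist x (z k) ≤ r → (x ∈ Set.range z ↔
      x - z k ∈ {v : E3 | ∃ b : Fin 3 → ℤ, v = latPt G hexFrame b ∨ v = latPt G hexFrame b - G (hcpShift + ξ)}) := by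
  intro x hx
  rw [hrange]
  constructor
  · rintro ⟨-, a, ha | ha⟩
    · exact ⟨a - ak, Or.inr (by rw [latPt_sub, ha, hak]; abel)⟩
    · exact ⟨a - ak, Or.inl (by rw [latPt_sub, ha, hak]; abel)⟩
  · rintro ⟨b, hb | hb⟩
    · refine ⟨by linarith [dist_triangle x (z k) (z c)], ak + b, Or.inr ?_⟩
      rw [latPt_add, ← sub_add_cancel x (z k), hb, hak]
      abel
    · refine ⟨by linarith [dist_triangle x (z k) (z c)], ak + b, Or.inl ?_⟩
      rw [latPt_add, ← sub_add_cancel x (z k), hb, hak]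
      abel

/-! ## §1. The deformed hcp ball is finite and has an injective enumeration -/

/-- The `133/10`-ball of `p + (U·L_hex ∪ (U·L_hex + U(hcpShift + ξ)))` lies in the union of the two images of the label box `[−22, 22]³`
(`‖U − 1‖ ≤ 1/4`, `‖ξ‖ ≤ 1/4`). [folklore] -/
theorem hcpBall_subset_image_box {U : E3 →L[ℝ] E3} {ξ : E3} (hU : ‖U - 1‖ ≤ 1 / 4) (hξ : ‖ξ‖ ≤ 1 / 4) (p : E3) :
    {x : E3 | dist x p ≤ 133 / 10 ∧ ∃ a : Fin 3 → ℤ, x = p + latPt U hexFrame a ∨ x = p + latPt U hexFrame a + U (hcpShift + ξ)} ⊆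
      (fun a : Fin 3 → ℤ => p + latPt U hexFrame a) '' ↑(Fintype.piFinset fun _ : Fin 3 => Finset.Icc (-(22 : ℤ)) 22) ∪
        (fun a : Fin 3 → ℤ => p + latPt U hexFrame a + U (hcpShift + ξ)) '' ↑(Fintype.piFinset fun _ : Fin 3 => Finset.Icc (-(22 : ℤ)) 22) := by
  rintro x ⟨hx, a, rfl | rfl⟩
  · refine Or.inl ⟨a, ?_, rfl⟩
    have hn : ‖latPt U hexFrame a‖ ≤ 133 / 10 := by simpa [dist_eq_norm] using hx
    have h34 := norm_apply_ge_of_near_one hU (latPt 1 hexFrame a)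
    rw [← latPt_eq_apply_one] at h34
    exact_mod_cast mem_box_of_norm_hexPt_lt' (ρ := 18) (K := 22) (by norm_num) (by linarith)
  · refine Or.inr ⟨a, ?_, rfl⟩
    have hn : ‖latPt U hexFrame a + U (hcpShift + ξ)‖ ≤ 133 / 10 := by
      have : dist (p + latPt U hexFrame a + U (hcpShift + ξ)) p = ‖latPt U hexFrame a + U (hcpShift + ξ)‖ := by
        rw [dist_eq_norm]; congr 1; abel
      rwa [this] at hx
    have h34 := norm_apply_ge_of_near_one hU (latPt 1 hexFrame a + hcpShift + ξ)
    rw [← shifted_eq_apply] at h34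
    have htri : ‖latPt 1 hexFrame a + hcpShift‖ ≤ ‖latPt 1 hexFrame a + hcpShift + ξ‖ + ‖ξ‖ := by
      calc ‖latPt 1 hexFrame a + hcpShift‖ = ‖(latPt 1 hexFrame a + hcpShift + ξ) - ξ‖ := by rw [add_sub_cancel_right]
        _ ≤ ‖latPt 1 hexFrame a + hcpShift + ξ‖ + ‖ξ‖ := norm_sub_le _ _
    exact_mod_cast mem_box_of_norm_hexPt_add_shift_lt' (ρ' := 73 / 4) (K := 22) (by norm_num) (by linarith)

/-- The deformed hcp ball is finite. [folklore] -/
theorem hcpBall_finite {U : E3 →L[ℝ] E3} {ξ : E3} (hU : ‖U - 1‖ ≤ 1 / 4) (hξ : ‖ξ‖ ≤ 1 / 4) (p : E3) :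
    {x : E3 | dist x p ≤ 133 / 10 ∧ ∃ a : Fin 3 → ℤ, x = p + latPt U hexFrame a ∨ x = p + latPt U hexFrame a + U (hcpShift + ξ)}.Finite :=
  ((((Finset.finite_toSet _).image _)).union ((Finset.finite_toSet _).image _)).subset (hcpBall_subset_image_box hU hξ p)

/-- ★ **Every deformed hcp ball is REALISED by an injective enumeration** centred at any point `p`. [folklore] -/
theorem exists_realisation_hcp {U : E3 →L[ℝ] E3} {ξ : E3} (hU : ‖U - 1‖ ≤ 1 / 4) (hξ : ‖ξ‖ ≤ 1 / 4) (p : E3) :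
    ∃ (M : ℕ) (z : Fin M → E3) (c : Fin M), Function.Injective z ∧ z c = p ∧
      Set.range z = {x : E3 | dist x (z c) ≤ 133 / 10 ∧ ∃ a : Fin 3 → ℤ,
        x = z c + latPt U hexFrame a ∨ x = z c + latPt U hexFrame a + U (hcpShift + ξ)} := by
  set S : Set E3 := {x : E3 | dist x p ≤ 133 / 10 ∧ ∃ a : Fin 3 → ℤ,
    x = p + latPt U hexFrame a ∨ x = p + latPt U hexFrame a + U (hcpShift + ξ)} with hS
  have hfin : S.Finite := hcpBall_finite hU hξ p
  letI : Fintype ↥S := hfin.fintype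
  have hp : p ∈ S := ⟨by simp only [dist_self]; norm_num, 0, Or.inl (by rw [latPt_zero, add_zero])⟩
  let e : ↥S ≃ Fin (Fintype.card ↥S) := Fintype.equivFin ↥S
  refine ⟨Fintype.card ↥S, fun i => ((e.symm i : ↥S) : E3), e ⟨p, hp⟩, ?_, ?_, ?_⟩
  · exact Subtype.val_injective.comp e.symm.injective
  · simp
  · have hzc : (fun i => ((e.symm i : ↥S) : E3)) (e ⟨p, hp⟩) = p := by simp
    rw [hzc]
    ext x
    constructor
    · rintro ⟨i, rfl⟩
      exact (e.symm i).2
    · intro hx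
      exact ⟨e ⟨x, hx⟩, by simp⟩

/-! ## §2. Admissibility from cluster-free certificates for `T_A` and `T_B`, and the A–B separation certificate -/

/-- ★ **Separation of a deformed hcp ball**: A–A and B–B distances are `≥ 3/4` automatically (`‖U − 1‖ ≤ 1/4`); with the A–B certificate
`∀ d, 7/10 ≤ ‖latPt U hexFrame d + U(hcpShift + ξ)‖` every injective enumeration is `7/10`-separated. [folklore] -/
theorem sep_of_hcp_range {U : E3 →L[ℝ] E3} {ξ : E3} (hU : ‖U - 1‖ ≤ 1 / 4) {M : ℕ} {z : Fin M → E3} {c : Fin M}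
    (hz : Function.Injective z)
    (hrange : Set.range z = {x : E3 | dist x (z c) ≤ 133 / 10 ∧ ∃ a : Fin 3 → ℤ,
      x = z c + latPt U hexFrame a ∨ x = z c + latPt U hexFrame a + U (hcpShift + ξ)})
    (hsepAB : ∀ d : Fin 3 → ℤ, 7 / 10 ≤ ‖latPt U hexFrame d + U (hcpShift + ξ)‖) : Sep z := by
  have hmem : ∀ k : Fin M, ∃ a : Fin 3 → ℤ, z k = z c + latPt U hexFrame a ∨ z k = z c + latPt U hexFrame a + U (hcpShift + ξ) := fun k => by
    have hk : z k ∈ Set.range z := ⟨k, rfl⟩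
    rw [hrange] at hk
    exact hk.2
  -- same-sublattice differences
  have hAA : ∀ d : Fin 3 → ℤ, d ≠ 0 → 7 / 10 ≤ ‖latPt U hexFrame d‖ := fun d hd => by
    have h1 := one_le_norm_sq_hexPt hd
    have h1' : 1 ≤ ‖latPt 1 hexFrame d‖ := by nlinarith [norm_nonneg (latPt 1 hexFrame d)]
    have h34 := norm_apply_ge_of_near_one hU (latPt 1 hexFrame d)
    rw [← latPt_eq_apply_one] at h34
    linarith
  intro a b hab
  obtain ⟨da, ha⟩ := hmem a
  obtain ⟨db, hb⟩ := hmem b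
  rw [dist_eq_norm]
  rcases ha with ha | ha <;> rcases hb with hb | hb
  · have hd : da - db ≠ 0 := by
      intro h
      have : z a = z b := by rw [ha, hb, sub_eq_zero.1 h]
      exact hab (hz this)
    have : z a - z b = latPt U hexFrame (da - db) := by rw [ha, hb, latPt_sub]; abel
    rw [this]; exact hAA _ hd
  · have : z a - z b = -(latPt U hexFrame (db - da) + U (hcpShift + ξ)) := by rw [ha, hb, latPt_sub]; abel
    rw [this, norm_neg]; exact hsepAB _
  · have : z a - z b = latPt U hexFrame (da - db) + U (hcpShift + ξ) := by rw [ha, hb, latPt_sub]; abel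
    rw [this]; exact hsepAB _
  · have hd : da - db ≠ 0 := by
      intro h
      have : z a = z b := by rw [ha, hb, sub_eq_zero.1 h]
      exact hab (hz this)
    have : z a - z b = latPt U hexFrame (da - db) := by rw [ha, hb, latPt_sub]; abel
    rw [this]; exact hAA _ hd

/-- ★★ **ADMISSIBILITY OF A DEFORMED hcp BALL FROM PARAMETRIC CERTIFICATES.**  For `T ∈ {T_A, T_B}`: (a) no site with radius-`5/2` homogeneity
is `1/20`-good, (b) every site with radius-`15/2` homogeneity is `1/8`-good, (c)/(d) no site with closed radius-`7` homogeneity is removal- /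
move-unstable; plus the A–B separation certificate ⟹ `Admissible M z c` for every injective enumeration. [folklore] -/
theorem admissible_of_certificates_hcp {U : E3 →L[ℝ] E3} {ξ : E3} (hU : ‖U - 1‖ ≤ 1 / 4) {M : ℕ} {z : Fin M → E3} {c : Fin M}
    (hz : Function.Injective z)
    (hrange : Set.range z = {x : E3 | dist x (z c) ≤ 133 / 10 ∧ ∃ a : Fin 3 → ℤ,
      x = z c + latPt U hexFrame a ∨ x = z c + latPt U hexFrame a + U (hcpShift + ξ)})
    (hsepAB : ∀ d : Fin 3 → ℤ, 7 / 10 ≤ ‖latPt U hexFrame d + U (hcpShift + ξ)‖)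
    (hbad20 : ∀ (T : Set E3), (T = {v : E3 | ∃ b : Fin 3 → ℤ, v = latPt U hexFrame b ∨ v = latPt U hexFrame b + U (hcpShift + ξ)} ∨
        T = {v : E3 | ∃ b : Fin 3 → ℤ, v = latPt U hexFrame b ∨ v = latPt U hexFrame b - U (hcpShift + ξ)}) →
      ∀ (M' : ℕ) (z' : Fin M' → E3) (j' : Fin M'),
        (∀ x : E3, dist x (z' j') < 5 / 2 → (x ∈ Set.range z' ↔ x - z' j' ∈ T)) → ¬GoodAtScale (1 / 20) (3 / 2) z' j')
    (hgood8 : ∀ (T : Set E3), (T = {v : E3 | ∃ b : Fin 3 → ℤ, v = latPt U hexFrame b ∨ v = latPt U hexFrame b + U (hcpShift + ξ)} ∨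
        T = {v : E3 | ∃ b : Fin 3 → ℤ, v = latPt U hexFrame b ∨ v = latPt U hexFrame b - U (hcpShift + ξ)}) →
      ∀ (M' : ℕ) (z' : Fin M' → E3) (j' : Fin M'),
        (∀ x : E3, dist x (z' j') < 15 / 2 → (x ∈ Set.range z' ↔ x - z' j' ∈ T)) → GoodAtScale (1 / 8) (3 / 2) z' j')
    (hrem : ∀ (T : Set E3), (T = {v : E3 | ∃ b : Fin 3 → ℤ, v = latPt U hexFrame b ∨ v = latPt U hexFrame b + U (hcpShift + ξ)} ∨
        T = {v : E3 | ∃ b : Fin 3 → ℤ, v = latPt U hexFrame b ∨ v = latPt U hexFrame b - U (hcpShift + ξ)}) →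
      ∀ (M' : ℕ) (z' : Fin M' → E3) (j' : Fin M'), Function.Injective z' →
        (∀ x : E3, dist x (z' j') ≤ 7 → (x ∈ Set.range z' ↔ x - z' j' ∈ T)) → ¬RemovalUnstableCore (-(7175 / 10000)) (1 / 10000) 7 M' z' j')
    (hmove : ∀ (T : Set E3), (T = {v : E3 | ∃ b : Fin 3 → ℤ, v = latPt U hexFrame b ∨ v = latPt U hexFrame b + U (hcpShift + ξ)} ∨
        T = {v : E3 | ∃ b : Fin 3 → ℤ, v = latPt U hexFrame b ∨ v = latPt U hexFrame b - U (hcpShift + ξ)}) →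
      ∀ (M' : ℕ) (z' : Fin M' → E3) (j' : Fin M'), Function.Injective z' →
        (∀ x : E3, dist x (z' j') ≤ 7 → (x ∈ Set.range z' ↔ x - z' j' ∈ T)) → ∀ s : ℝ, 0 ≤ s → s ≤ 3 / 2 → ¬MoveUnstableCore 0 7 s M' z' j') :
    Admissible M z c := by
  have hmem : ∀ k : Fin M, dist (z k) (z c) ≤ 133 / 10 ∧
      ∃ a : Fin 3 → ℤ, z k = z c + latPt U hexFrame a ∨ z k = z c + latPt U hexFrame a + U (hcpShift + ξ) := fun k => by
    have hk : z k ∈ Set.range z := ⟨k, rfl⟩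
    rw [hrange] at hk
    exact hk
  -- open / closed homogeneity at any site within `ρ` of the centre, radius `r`, for the site's own displacement set
  have hsite : ∀ (k : Fin M) {ρ r : ℝ}, dist (z k) (z c) ≤ ρ → r + ρ ≤ 133 / 10 → ∃ T : Set E3,
      (T = {v : E3 | ∃ b : Fin 3 → ℤ, v = latPt U hexFrame b ∨ v = latPt U hexFrame b + U (hcpShift + ξ)} ∨
        T = {v : E3 | ∃ b : Fin 3 → ℤ, v = latPt U hexFrame b ∨ v = latPt U hexFrame b - U (hcpShift + ξ)}) ∧
      (∀ x : E3, dist x (z k) < r → (x ∈ Set.range z ↔ x - z k ∈ T)) := by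
    intro k ρ r hk hr
    obtain ⟨-, ak, hA | hB⟩ := hmem k
    · exact ⟨_, Or.inl rfl, locHom_hcpA_site hrange hk hr hA⟩
    · exact ⟨_, Or.inr rfl, locHom_hcpB_site hrange hk hr hB⟩
  have hsite_closed : ∀ (k : Fin M) {ρ r : ℝ}, dist (z k) (z c) ≤ ρ → r + ρ ≤ 133 / 10 → ∃ T : Set E3,
      (T = {v : E3 | ∃ b : Fin 3 → ℤ, v = latPt U hexFrame b ∨ v = latPt U hexFrame b + U (hcpShift + ξ)} ∨
        T = {v : E3 | ∃ b : Fin 3 → ℤ, v = latPt U hexFrame b ∨ v = latPt U hexFrame b - U (hcpShift + ξ)}) ∧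
      (∀ x : E3, dist x (z k) ≤ r → (x ∈ Set.range z ↔ x - z k ∈ T)) := by
    intro k ρ r hk hr
    obtain ⟨-, ak, hA | hB⟩ := hmem k
    · exact ⟨_, Or.inl rfl, locHom_hcpA_site_closed hrange hk hr hA⟩
    · exact ⟨_, Or.inr rfl, locHom_hcpB_site_closed hrange hk hr hB⟩
  refine ⟨hz, sep_of_hcp_range hU hz hrange hsepAB, fun k => (hmem k).1, ?_, ?_, ?_⟩
  · rintro ⟨j, hj, hgood⟩
    obtain ⟨T, hT, hloc⟩ := hsite j (r := 5 / 2) (mem_ball.1 hj) (by norm_num)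
    exact hbad20 T hT M z j hloc hgood
  · rintro ⟨j, hj, hEx⟩
    unfold ExRec Collar at hEx
    obtain ⟨k, hk, hor⟩ := hEx
    have hkc : dist (z k) (z c) ≤ 63 / 10 := by
      have := dist_triangle (z k) (z j) (z c)
      linarith [mem_ball.1 hk, mem_ball.1 hj]
    rcases hor with ⟨s, hs0, hs1, hne⟩ | hgood
    · obtain ⟨T, hT, hloc7⟩ := hsite_closed k (r := 7) hkc (by norm_num)
      rcases hne with hmv | hrm
      · exact hmove T hT M z k hz hloc7 s hs0 hs1 hmv
      · exact hrem T hT M z k hz hloc7 hrm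
    · obtain ⟨T, hT, hloc⟩ := hsite k (r := 5 / 2) hkc (by norm_num)
      exact hbad20 T hT M z k hloc hgood
  · rintro ⟨j, hj, hnot⟩
    obtain ⟨T, hT, hloc⟩ := hsite j (r := 15 / 2) (mem_ball.1 hj) (by norm_num)
    exact hnot (hgood8 T hT M z j hloc)

/-! ## §3. `(R)` from a floor number and the certificates (hcp reference) -/

/-- ★★★ **`(R)` FROM A FLOOR NUMBER AND PARAMETRIC CERTIFICATES AT ONE hcp-TYPE REFERENCE** (`‖U − 1‖ ≤ 1/4`, `‖ξ‖ ≤ 1/4`; the reference of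
record, family A, is of this type). [folklore] -/
theorem textureReliefBound_of_floor_of_certificates_hcp {L B : ℝ} {U : E3 →L[ℝ] E3} {ξ : E3} (hU : ‖U - 1‖ ≤ 1 / 4) (hξ : ‖ξ‖ ≤ 1 / 4)
    (hsepAB : ∀ d : Fin 3 → ℤ, 7 / 10 ≤ ‖latPt U hexFrame d + U (hcpShift + ξ)‖)
    (hbad20 : ∀ (T : Set E3), (T = {v : E3 | ∃ b : Fin 3 → ℤ, v = latPt U hexFrame b ∨ v = latPt U hexFrame b + U (hcpShift + ξ)} ∨
        T = {v : E3 | ∃ b : Fin 3 → ℤ, v = latPt U hexFrame b ∨ v = latPt U hexFrame b - U (hcpShift + ξ)}) →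
      ∀ (M' : ℕ) (z' : Fin M' → E3) (j' : Fin M'),
        (∀ x : E3, dist x (z' j') < 5 / 2 → (x ∈ Set.range z' ↔ x - z' j' ∈ T)) → ¬GoodAtScale (1 / 20) (3 / 2) z' j')
    (hgood8 : ∀ (T : Set E3), (T = {v : E3 | ∃ b : Fin 3 → ℤ, v = latPt U hexFrame b ∨ v = latPt U hexFrame b + U (hcpShift + ξ)} ∨
        T = {v : E3 | ∃ b : Fin 3 → ℤ, v = latPt U hexFrame b ∨ v = latPt U hexFrame b - U (hcpShift + ξ)}) →
      ∀ (M' : ℕ) (z' : Fin M' → E3) (j' : Fin M'),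
        (∀ x : E3, dist x (z' j') < 15 / 2 → (x ∈ Set.range z' ↔ x - z' j' ∈ T)) → GoodAtScale (1 / 8) (3 / 2) z' j')
    (hrem : ∀ (T : Set E3), (T = {v : E3 | ∃ b : Fin 3 → ℤ, v = latPt U hexFrame b ∨ v = latPt U hexFrame b + U (hcpShift + ξ)} ∨
        T = {v : E3 | ∃ b : Fin 3 → ℤ, v = latPt U hexFrame b ∨ v = latPt U hexFrame b - U (hcpShift + ξ)}) →
      ∀ (M' : ℕ) (z' : Fin M' → E3) (j' : Fin M'), Function.Injective z' →
        (∀ x : E3, dist x (z' j') ≤ 7 → (x ∈ Set.range z' ↔ x - z' j' ∈ T)) → ¬RemovalUnstableCore (-(7175 / 10000)) (1 / 10000) 7 M' z' j')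
    (hmove : ∀ (T : Set E3), (T = {v : E3 | ∃ b : Fin 3 → ℤ, v = latPt U hexFrame b ∨ v = latPt U hexFrame b + U (hcpShift + ξ)} ∨
        T = {v : E3 | ∃ b : Fin 3 → ℤ, v = latPt U hexFrame b ∨ v = latPt U hexFrame b - U (hcpShift + ξ)}) →
      ∀ (M' : ℕ) (z' : Fin M' → E3) (j' : Fin M'), Function.Injective z' →
        (∀ x : E3, dist x (z' j') ≤ 7 → (x ∈ Set.range z' ↔ x - z' j' ∈ T)) → ∀ s : ℝ, 0 ≤ s → s ≤ 3 / 2 → ¬MoveUnstableCore 0 7 s M' z' j')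
    (hfloor : ∀ (M : ℕ) (z : Fin M → E3) (c : Fin M), Admissible M z c →
      (∑ᶠ v ∈ {v : E3 | v ≠ 0 ∧ ∃ b : Fin 3 → ℤ, v = latPt U hexFrame b ∨ v = latPt U hexFrame b + U (hcpShift + ξ)},
          effPot w₄₅ ω₄ (3 / 400) ‖v‖) / 2 - (-(7175 / 10000) + 3 / 400) - (L * sigmaOne + B) ≤ ballAvg (9 / 5) z (xRec M z) c) :
    TextureReliefBound L B := by
  obtain ⟨M₀, z₀, c₀, hz₀, -, hrange₀⟩ := exists_realisation_hcp hU hξ 0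
  exact textureReliefBound_of_floor_of_realised_hcp hU hξ
    (admissible_of_certificates_hcp hU hz₀ hrange₀ hsepAB hbad20 hgood8 hrem hmove) hrange₀ hfloor

end Summit.AtomisticToContinuum.Crystallization.Theorems.FrustratedLawDichotomyStrainedPatchHomWitnessHcp

end
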